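import Literature.Probability.LatticeModels.GaussianPairingBound
import Literature.Probability.LatticeModels.GKSInequalities
import HarnessLib

/-!
# Newman's Gaussian inequality for general ferromagnetic pair couplings on a finite set

Topic `Literature/Probability/LatticeModels`. The tree's `GaussianPairingBound` proves the Gaussian
(pairing) inequality `⟨σ_{x₁}⋯σ_{x₂ₘ}⟩ ≤ 𝒢_m[⟨σσ⟩](x)` (`nPoint_le_pairingSum_univ_free`) for the free,
zero-field Ising model on an ARBITRARY FINITE SIMPLE GRAPH with the SAME coupling `β ≥ 0` on every
edge (random currents + switching lemma, after Aizenman 1982 / Aizenman–Duminil-Copin 2021 §6.3).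
This file extends it to arbitrary nonnegative pair couplings `c_{a,b} ≥ 0` on a finite set `ι`
(Newman 1975, Theorem 3: the Gaussian inequality for general spin-½ ferromagnetic pair
interactions), and derives Newman's Gaussian domination of the even moments of `X = ∑_a g_a σ_a`,
`g ≥ 0`: `⟨X^{2m}⟩ ≤ (2m-1)!! ⟨X²⟩^m` (Newman 1975 CMP, Theorem 5, eq. (2.8)), which is the input
`newman_gaussian_evenMoment_le` of the long-range triviality barrier
(`Literature/Barriers/CriticalPhenomena/LongRangeTrivialityOnZ3Moments.lean`).

## The argument (ours; a reduction to the tree's unit-coupling theorem)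

* `PairIsing.avg c f = ∑_σ f(σ) e^{∑_{a,b} c_{a,b}σ_aσ_b} / ∑_σ e^{∑_{a,b} c_{a,b}σ_aσ_b}` is the Gibbs
  average of the pair-interaction model on the finite set `ι` (ordered-pair couplings; the diagonal
  only contributes constants, `avg_offDiag`).
* **Decoration** (Fisher's decoration transformation, run backwards). For `k : ι → ι → ℕ` vanishing
  on the diagonal, the decorated graph `decorGraph k` on `ι ⊕ Decor k` has `k a b` fresh vertices
  for the ordered pair `(a,b)`, each joined to `a` and to `b` and to nothing else. Summing out a
  decoration spin at coupling `β₀` gives `∑_{w=±1} e^{β₀w(σ_a+σ_b)} = 2e^{K}e^{Kσ_aσ_b}` with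
  `K = K(β₀) = ½ log cosh 2β₀` (`sum_units_exp_decoration`), so the `ι`-marginal of the free Ising
  model on `decorGraph k` at uniform coupling `β₀` is EXACTLY `avg (K(β₀)·k)`
  (`isingExpect_decorGraph_comp_inl`). Site correlations of the decorated model obey the tree's
  pairing bound, hence so does `avg (K(β₀)·k)` (`avg_spinMonomial_le_pairingSum_decor`).
* **Approximation.** `K(1/(n+1)) → 0⁺`, and `K_n⌊c_{a,b}/K_n⌋₊ → c_{a,b}`; finite-volume averages
  are continuous in the couplings (`continuous_avg`) and so is the pairing functional
  (`tendsto_pairingSum`), so the inequality passes to arbitrary `c ≥ 0`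
  (`avg_spinMonomial_le_pairingSum`).
* **Moments.** Expanding `(∑ g_aσ_a)^{2m}` and smearing Wick's law (`sum_prod_mul_pairingSum`, tree)
  gives `avg_pow_two_mul_le`.

## References

* C. M. Newman, *Gaussian correlation inequalities for ferromagnets*, Z. Wahrsch. verw. Gebiete 33
  (1975) 75–93, Theorem 3, eqs. (3.6)–(3.7) [Newman1975Gaussian] (read pp. 75–80).
* C. M. Newman, *Inequalities for Ising models and field theories which obey the Lee–Yang theorem*,
  Comm. Math. Phys. 41 (1975) 1–9, Theorem 5, eq. (2.8) [Newman1975].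
* M. Aizenman, H. Duminil-Copin, Ann. of Math. 194 (2021), arXiv:1912.07973, §6.3
  [AizenmanDuminilCopinAnnals2021] (the unit-coupling inequality proved in `GaussianPairingBound`).
* M. E. Fisher, *Transformations of Ising models*, Phys. Rev. 113 (1959) 969–981 [Fisher1959]
  (decoration transformation; paywalled, not consulted — the one identity used is proved here).
* S. Friedli, Y. Velenik, *Statistical Mechanics of Lattice Systems*, CUP (2017), §3.1 eq. (3.8)
  [FriedliVelenik2017].

## Design / not here

`PairIsing.weight` / `PairIsing.avg` are an ABBREVIATION for the pair-support instance of the tree's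
general finite spin system of Friedli–Velenik §3.8.1 (`gksWeight` / `gksExpect` of
`GKSInequalities.lean`, index set `ι × ι`, couplings `K_{(a,b)} = c_{a,b}`, supports `{a,b}` off the
diagonal and `∅` on it): `weight_eq_gksWeight`, `avg_eq_gksExpect` — so GKS I/II, Griffiths'
comparison `gksExpect_mono_of_abs_le` and the GHS inequality `ghs_gksSum` of the tree apply to
`avg` (e.g. `avg_spinProduct_nonneg`). The curried spelling `c : ι → ι → ℝ` is kept because the
decoration transformation and the continuity argument are statements about the coupling MATRIX.
Everything is finite-dimensional and elementary (finite sums of exponentials); no measure theory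
beyond the tree's bridge `integral_isingMeasure`. The upper half of Aizenman's inequality (the
`U₄`-correction) is NOT treated. The specialisation to the finite-volume states `expectIn J Λ β 0` of
`ℤ^d` pair interactions is in `Literature/Barriers/CriticalPhenomena/LongRangeTrivialityOnZ3Newman.lean`.

## Mathlib / tree anchors

`Fintype.prod_sum`, `Fintype.sum_sigma`, `Fintype.sum_equiv`, `Equiv.sumArrowEquivProdArrow`,
`Sym2.eq_iff`, `SimpleGraph.mem_edgeFinset`, `Finset.sum_pow'`, `Nat.floor_le`, `Nat.lt_floor_add_one`,
`Real.one_lt_cosh`, `tendsto_of_tendsto_of_tendsto_of_le_of_le`, `le_of_tendsto_of_tendsto'`; tree: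
`nPoint_le_pairingSum_univ_free`, `pairingSum_congr_of_eq`, `tendsto_pairingSum`,
`sum_prod_mul_pairingSum`, `isingWeight_univ_free_eq`, `integral_isingMeasure`, `UnitsInt.univ`,
`gksExpect`, `gksExpect_spinProduct_nonneg` (`GKSInequalities`).
-/

noncomputable section

open MeasureTheory Finset Filter Topology
open scoped Nat

namespace Literature.Probability.LatticeModels

namespace PairIsing

variable {ι : Type*} [Fintype ι] [DecidableEq ι]

/-- The Boltzmann weight `exp(∑_{a,b} c_{a,b} σ_a σ_b)` of the Ising model on the finite set `ι` with
the (ordered-)pair couplings `c : ι → ι → ℝ` (free boundary condition, zero field; diagonal terms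
are constants). [cite: Newman1975, eq. (1.1)] -/
def weight (c : ι → ι → ℝ) (ρ : SpinConfig ι) : ℝ :=
  Real.exp (∑ a, ∑ b, c a b * (spinAt a ρ * spinAt b ρ))

/-- The Gibbs average `⟨f⟩_c = ∑_σ f(σ) w_c(σ) / ∑_σ w_c(σ)` of the pair-interaction Ising model on
the finite set `ι`. [cite: Newman1975, eq. (1.1)] -/
def avg (c : ι → ι → ℝ) (f : SpinConfig ι → ℝ) : ℝ :=
  (∑ ρ, f ρ * weight c ρ) / ∑ ρ, weight c ρ

/-- The couplings with the diagonal removed. [folklore] -/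
def offDiag (c : ι → ι → ℝ) (a b : ι) : ℝ := if a = b then 0 else c a b

omit [DecidableEq ι] in
/-- Boltzmann weights are positive. [folklore] -/
theorem weight_pos (c : ι → ι → ℝ) (ρ : SpinConfig ι) : 0 < weight c ρ := Real.exp_pos _

/-- The partition function is positive. [folklore] -/
theorem sum_weight_pos (c : ι → ι → ℝ) : 0 < ∑ ρ, weight c ρ :=
  Finset.sum_pos (fun ρ _ => weight_pos c ρ) Finset.univ_nonempty

/-- Unfolding of `avg`. [folklore] -/
theorem avg_def (c : ι → ι → ℝ) (f : SpinConfig ι → ℝ) :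
    avg c f = (∑ ρ, f ρ * weight c ρ) / ∑ ρ, weight c ρ := rfl

/-- Additivity of the Gibbs average. [folklore] -/
theorem avg_add (c : ι → ι → ℝ) (f g : SpinConfig ι → ℝ) :
    avg c (fun ρ => f ρ + g ρ) = avg c f + avg c g := by
  simp only [avg, add_mul, Finset.sum_add_distrib, add_div]

/-- Homogeneity of the Gibbs average. [folklore] -/
theorem avg_const_mul (c : ι → ι → ℝ) (r : ℝ) (f : SpinConfig ι → ℝ) :
    avg c (fun ρ => r * f ρ) = r * avg c f := by
  simp only [avg, mul_assoc, ← Finset.mul_sum, mul_div_assoc]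

/-- The Gibbs average commutes with finite sums. [folklore] -/
theorem avg_finset_sum (c : ι → ι → ℝ) {κ : Type*} (s : Finset κ) (f : κ → SpinConfig ι → ℝ) :
    avg c (fun ρ => ∑ i ∈ s, f i ρ) = ∑ i ∈ s, avg c (f i) := by
  simp only [avg, Finset.sum_mul, Finset.sum_div]
  exact Finset.sum_comm

/-- `⟨r⟩ = r`. [folklore] -/
theorem avg_const (c : ι → ι → ℝ) (r : ℝ) : avg c (fun _ => r) = r := by
  rw [avg, ← Finset.mul_sum, mul_div_assoc, div_self (sum_weight_pos c).ne', mul_one]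

/-- `⟨f⟩ ≥ 0` for `f ≥ 0`. [folklore] -/
theorem avg_nonneg (c : ι → ι → ℝ) {f : SpinConfig ι → ℝ} (hf : ∀ ρ, 0 ≤ f ρ) : 0 ≤ avg c f :=
  div_nonneg (Finset.sum_nonneg fun ρ _ => mul_nonneg (hf ρ) (weight_pos c ρ).le) (sum_weight_pos c).le

/-- The exponent splits into the constant diagonal part and the off-diagonal part (`σ_a² = 1`). [folklore] -/
theorem sum_sum_coupling_eq (c : ι → ι → ℝ) (ρ : SpinConfig ι) :
    ∑ a, ∑ b, c a b * (spinAt a ρ * spinAt b ρ) =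
      (∑ a, c a a) + ∑ a, ∑ b, offDiag c a b * (spinAt a ρ * spinAt b ρ) := by
  rw [← Finset.sum_add_distrib]
  refine Finset.sum_congr rfl fun a _ => ?_
  have h : ∀ b, c a b * (spinAt a ρ * spinAt b ρ) =
      (if a = b then c a b * (spinAt a ρ * spinAt b ρ) else 0) + offDiag c a b * (spinAt a ρ * spinAt b ρ) := by
    intro b
    unfold offDiag
    split_ifs <;> ring
  rw [Finset.sum_congr rfl fun b _ => h b, Finset.sum_add_distrib, Finset.sum_ite_eq]
  simp

/-- `w_c = e^{∑_a c_{a,a}} w_{offDiag c}`. [folklore] -/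
theorem weight_eq_exp_mul_weight_offDiag (c : ι → ι → ℝ) (ρ : SpinConfig ι) :
    weight c ρ = Real.exp (∑ a, c a a) * weight (offDiag c) ρ := by
  rw [weight, weight, sum_sum_coupling_eq, Real.exp_add]

/-- The Gibbs average does not see the diagonal couplings. [folklore] -/
theorem avg_offDiag (c : ι → ι → ℝ) (f : SpinConfig ι → ℝ) : avg (offDiag c) f = avg c f := by
  rw [avg, avg]
  simp_rw [weight_eq_exp_mul_weight_offDiag c]
  rw [show ∑ ρ, f ρ * (Real.exp (∑ a, c a a) * weight (offDiag c) ρ) =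
      Real.exp (∑ a, c a a) * ∑ ρ, f ρ * weight (offDiag c) ρ by
    rw [Finset.mul_sum]; exact Finset.sum_congr rfl fun ρ _ => by ring,
    ← Finset.mul_sum, mul_div_mul_left _ _ (Real.exp_pos _).ne']

/-- **`PairIsing.weight` is the weight of the tree's general spin system `ν_{Λ;K}` (Friedli–Velenik
§3.8.1) with index set `ι × ι`, couplings `K_{(a,b)} = c_{a,b}` and supports `C_{(a,b)} = {a,b}`
(`∅` on the diagonal, where `σ_a² = 1`).** [cite: FriedliVelenik2017, §3.8.1, p. 141] -/
theorem weight_eq_gksWeight (c : ι → ι → ℝ) (ρ : SpinConfig ι) :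
    weight c ρ = gksWeight (univ : Finset (ι × ι)) (Function.uncurry c)
      (fun p => if p.1 = p.2 then ∅ else {p.1, p.2}) ρ := by
  rw [weight, gksWeight, gksHamiltonian]
  congr 1
  rw [← Finset.univ_product_univ, Finset.sum_product]
  refine Finset.sum_congr rfl fun a _ => Finset.sum_congr rfl fun b _ => ?_
  simp only [Function.uncurry_apply_pair]
  by_cases hab : a = b
  · subst hab
    rw [if_pos rfl, spinProduct, Finset.prod_empty, spinAt_mul_self]
  · rw [if_neg hab, spinProduct, Finset.prod_pair hab]

/-- **`PairIsing.avg` is the corresponding instance of the tree's `gksExpect`** (so that GKS I/II,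
Griffiths' comparison of couplings and GHS of `GKSInequalities.lean` / `GHSInequality.lean` apply to
it). [cite: FriedliVelenik2017, §3.8.1, p. 141] -/
theorem avg_eq_gksExpect (c : ι → ι → ℝ) (f : SpinConfig ι → ℝ) :
    avg c f = gksExpect (univ : Finset (ι × ι)) (Function.uncurry c)
      (fun p => if p.1 = p.2 then ∅ else {p.1, p.2}) f := by
  rw [avg, gksExpect, gksSum, gksSum]
  simp_rw [weight_eq_gksWeight, one_mul]

/-- GKS I for the pair-interaction average: `⟨σ_A⟩_c ≥ 0` for `c ≥ 0` (through `avg_eq_gksExpect`).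
[cite: FriedliVelenik2017, Thm. 3.49, eq. (3.54)] -/
theorem avg_spinProduct_nonneg {c : ι → ι → ℝ} (hc : ∀ a b, 0 ≤ c a b) (A : Finset ι) :
    0 ≤ avg c (spinProduct A) := by
  rw [avg_eq_gksExpect]
  exact gksExpect_spinProduct_nonneg _ _ _ (fun p _ => hc p.1 p.2) A

omit [DecidableEq ι] in
/-- Continuity of the weights in the couplings. [folklore] -/
theorem continuous_weight (ρ : SpinConfig ι) : Continuous fun c : ι → ι → ℝ => weight c ρ := by
  unfold weight
  refine Real.continuous_exp.comp ?_
  refine continuous_finsetSum _ fun a _ => continuous_finsetSum _ fun b _ => ?_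
  exact (continuous_apply_apply a b).mul continuous_const

/-- Continuity of the Gibbs average in the couplings (finite sums of exponentials over a positive
partition function). [folklore] -/
theorem continuous_avg (f : SpinConfig ι → ℝ) : Continuous fun c : ι → ι → ℝ => avg c f := by
  unfold avg
  refine Continuous.div ?_ ?_ fun c => (sum_weight_pos c).ne'
  · exact continuous_finsetSum _ fun ρ _ => continuous_const.mul (continuous_weight ρ)
  · exact continuous_finsetSum _ fun ρ _ => continuous_weight ρ


/-! ### The decorated graph -/

/-- Decoration index: `k a b` extra spins for the ordered pair `(a, b)`, each joined to `a` and to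
`b` (Fisher's decoration transformation, run backwards). [folklore] -/
abbrev Decor (k : ι → ι → ℕ) : Type _ := Σ a : ι, Σ _b : ι, Fin (k a _b)

/-- Adjacency of the decorated graph on `ι ⊕ Decor k`: the decoration spin `s = ⟨a, b, i⟩` is joined
to the sites `a` and `b`, and there are no other edges. [folklore] -/
def decorAdj (k : ι → ι → ℕ) : ι ⊕ Decor k → ι ⊕ Decor k → Prop
  | Sum.inl a, Sum.inr s => a = s.1 ∨ a = s.2.1
  | Sum.inr s, Sum.inl a => a = s.1 ∨ a = s.2.1
  | Sum.inl _, Sum.inl _ => False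
  | Sum.inr _, Sum.inr _ => False

/-- Adjacency of the decorated graph is decidable. [folklore] -/
instance decorAdj.decidableRel (k : ι → ι → ℕ) : DecidableRel (decorAdj k) := fun u v =>
  match u, v with
  | Sum.inl a, Sum.inr s => inferInstanceAs (Decidable (a = s.1 ∨ a = s.2.1))
  | Sum.inr s, Sum.inl a => inferInstanceAs (Decidable (a = s.1 ∨ a = s.2.1))
  | Sum.inl _, Sum.inl _ => inferInstanceAs (Decidable False)
  | Sum.inr _, Sum.inr _ => inferInstanceAs (Decidable False)

/-- The decorated graph: sites `ι`, decoration spins `Decor k`, every decoration spin `⟨a, b, i⟩`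
joined to `a` and `b`. [folklore] -/
def decorGraph (k : ι → ι → ℕ) : SimpleGraph (ι ⊕ Decor k) where
  Adj := decorAdj k
  symm := ⟨fun u v h => by
    cases u with
    | inl a => cases v with
      | inl b => exact h.elim
      | inr s => exact h
    | inr s => cases v with
      | inl b => exact h
      | inr t => exact h.elim⟩
  loopless := ⟨fun u h => by
    cases u with
    | inl a => exact h.elim
    | inr s => exact h.elim⟩

/-- Adjacency of the decorated graph is decidable. [folklore] -/
instance decorGraph.decidableRel (k : ι → ι → ℕ) : DecidableRel (decorGraph k).Adj :=
  decorAdj.decidableRel k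

omit [Fintype ι] [DecidableEq ι] in
/-- A site is adjacent to the decorations hanging on it. [folklore] -/
@[simp] theorem decorGraph_adj_inl_inr (k : ι → ι → ℕ) (a : ι) (s : Decor k) :
    (decorGraph k).Adj (Sum.inl a) (Sum.inr s) ↔ (a = s.1 ∨ a = s.2.1) := Iff.rfl

omit [Fintype ι] [DecidableEq ι] in
/-- A decoration is adjacent to its two sites. [folklore] -/
@[simp] theorem decorGraph_adj_inr_inl (k : ι → ι → ℕ) (a : ι) (s : Decor k) :
    (decorGraph k).Adj (Sum.inr s) (Sum.inl a) ↔ (a = s.1 ∨ a = s.2.1) := Iff.rfl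

omit [Fintype ι] [DecidableEq ι] in
/-- No site–site edges in the decorated graph. [folklore] -/
@[simp] theorem decorGraph_not_adj_inl_inl (k : ι → ι → ℕ) (a b : ι) :
    ¬ (decorGraph k).Adj (Sum.inl a) (Sum.inl b) := fun h => h.elim

omit [Fintype ι] [DecidableEq ι] in
/-- No decoration–decoration edges in the decorated graph. [folklore] -/
@[simp] theorem decorGraph_not_adj_inr_inr (k : ι → ι → ℕ) (s t : Decor k) :
    ¬ (decorGraph k).Adj (Sum.inr s) (Sum.inr t) := fun h => h.elim

omit [Fintype ι] [DecidableEq ι] in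
/-- When `k` vanishes on the diagonal, the two ends of a decoration are distinct sites. [folklore] -/
theorem Decor.fst_ne {k : ι → ι → ℕ} (hk : ∀ a, k a a = 0) (s : Decor k) : s.1 ≠ s.2.1 := by
  obtain ⟨a, b, i⟩ := s
  rintro (rfl : a = b)
  exact Nat.not_lt_zero _ (lt_of_lt_of_eq i.2 (hk a))

/-- **The edges of the decorated graph**: exactly the `2|Decor k|` edges `{s, s.1}`, `{s, s.2.1}`;
hence edge sums are sums over decorations. [folklore] -/
theorem sum_edgeFinset_decorGraph {k : ι → ι → ℕ} (hk : ∀ a, k a a = 0) {M : Type*} [AddCommMonoid M]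
    (f : Sym2 (ι ⊕ Decor k) → M) :
    ∑ e ∈ (decorGraph k).edgeFinset, f e =
      ∑ s : Decor k, (f s(Sum.inr s, Sum.inl s.1) + f s(Sum.inr s, Sum.inl s.2.1)) := by
  classical
  have h1 : Function.Injective fun s : Decor k => (s(Sum.inr s, Sum.inl s.1) : Sym2 (ι ⊕ Decor k)) := by
    intro s t hst
    rcases Sym2.eq_iff.1 hst with ⟨h, -⟩ | ⟨h, -⟩
    · exact Sum.inr_injective h
    · exact absurd h Sum.inr_ne_inl
  have h2 : Function.Injective fun s : Decor k => (s(Sum.inr s, Sum.inl s.2.1) : Sym2 (ι ⊕ Decor k)) := by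
    intro s t hst
    rcases Sym2.eq_iff.1 hst with ⟨h, -⟩ | ⟨h, -⟩
    · exact Sum.inr_injective h
    · exact absurd h Sum.inr_ne_inl
  have hdisj : Disjoint (univ.image fun s : Decor k => (s(Sum.inr s, Sum.inl s.1) : Sym2 (ι ⊕ Decor k)))
      (univ.image fun s : Decor k => (s(Sum.inr s, Sum.inl s.2.1) : Sym2 (ι ⊕ Decor k))) := by
    rw [Finset.disjoint_left]
    intro e he1 he2
    obtain ⟨s, -, rfl⟩ := Finset.mem_image.1 he1
    obtain ⟨t, -, hts⟩ := Finset.mem_image.1 he2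
    rcases Sym2.eq_iff.1 hts with ⟨h, h'⟩ | ⟨h, -⟩
    · have hst : t = s := Sum.inr_injective h
      subst hst
      exact Decor.fst_ne hk t (Sum.inl_injective h').symm
    · exact absurd h Sum.inr_ne_inl
  have hE : (decorGraph k).edgeFinset =
      (univ.image fun s : Decor k => (s(Sum.inr s, Sum.inl s.1) : Sym2 (ι ⊕ Decor k))) ∪
        univ.image fun s : Decor k => (s(Sum.inr s, Sum.inl s.2.1) : Sym2 (ι ⊕ Decor k)) := by
    ext e
    rw [SimpleGraph.mem_edgeFinset, Finset.mem_union, Finset.mem_image, Finset.mem_image]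
    induction e using Sym2.ind with
    | _ u v =>
      rw [SimpleGraph.mem_edgeSet]
      constructor
      · intro h
        cases u with
        | inl a => cases v with
          | inl b => exact h.elim
          | inr s =>
            rcases h with rfl | rfl
            · exact Or.inl ⟨s, mem_univ _, Sym2.eq_swap⟩
            · exact Or.inr ⟨s, mem_univ _, Sym2.eq_swap⟩
        | inr s => cases v with
          | inl b =>
            rcases h with rfl | rfl
            · exact Or.inl ⟨s, mem_univ _, rfl⟩
            · exact Or.inr ⟨s, mem_univ _, rfl⟩
          | inr t => exact h.elim
      · rintro (⟨s, -, hs⟩ | ⟨s, -, hs⟩)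
        · rcases Sym2.eq_iff.1 hs with ⟨rfl, rfl⟩ | ⟨rfl, rfl⟩
          · exact (decorGraph_adj_inr_inl k _ s).2 (Or.inl rfl)
          · exact (decorGraph_adj_inl_inr k _ s).2 (Or.inl rfl)
        · rcases Sym2.eq_iff.1 hs with ⟨rfl, rfl⟩ | ⟨rfl, rfl⟩
          · exact (decorGraph_adj_inr_inl k _ s).2 (Or.inr rfl)
          · exact (decorGraph_adj_inl_inr k _ s).2 (Or.inr rfl)
  rw [hE, Finset.sum_union hdisj, Finset.sum_image fun s _ t _ h => h1 h,
    Finset.sum_image fun s _ t _ h => h2 h, ← Finset.sum_add_distrib]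


/-! ### Free Ising expectations on a whole finite graph as finite sums -/

section WholeGraph

variable {V : Type*} [Fintype V] [DecidableEq V] (G : SimpleGraph V) [DecidableRel G.Adj]

/-- **Zero-field free expectations on the whole finite graph**:
`⟨F⟩_{V;β,0} = ∑_σ F(σ) e^{β∑_{e} σ_e} / ∑_σ e^{β∑_e σ_e}`, sums over all `σ : V → {±1}` and over the
edges `e = {x,y}` of `G`, `σ_e = σ_xσ_y`. [cite: FriedliVelenik2017, §3.1, eq. (3.8)] -/
theorem isingExpect_univ_free_eq_sum_div (β : ℝ) (F : SpinConfig V → ℝ) :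
    isingExpect G univ β 0 .free F =
      (∑ σ : SpinConfig V, F σ * Real.exp (β * ∑ e ∈ G.edgeFinset, bondSpin σ e)) /
        ∑ σ : SpinConfig V, Real.exp (β * ∑ e ∈ G.edgeFinset, bondSpin σ e) := by
  classical
  set eqv : (↥(univ : Finset V) → ℤˣ) ≃ SpinConfig V :=
    (Equiv.subtypeUnivEquiv (fun x : V => Finset.mem_univ x)).arrowCongr (Equiv.refl ℤˣ) with heqv
  have hglue : ∀ τ : ↥(univ : Finset V) → ℤˣ, glue univ τ .free = eqv τ := by
    intro τ; funext x
    rw [glue_apply_of_mem _ _ _ (Finset.mem_univ x)]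
    simp [heqv, Equiv.arrowCongr_apply, Equiv.subtypeUnivEquiv]
  have hw : ∀ τ : ↥(univ : Finset V) → ℤˣ, isingWeight G univ β 0 .free τ =
      Real.exp (β * ∑ e ∈ G.edgeFinset, bondSpin (eqv τ) e) := by
    intro τ
    rw [isingWeight_univ_free_eq, hglue, Finset.prod_coe_sort G.edgeFinset
      (fun e => Real.exp (β * bondSpin (eqv τ) e)), ← Real.exp_sum, Finset.mul_sum]
  rw [isingExpect, integral_isingMeasure G univ β 0 .free (measurable_of_finite F), isingPartitionFunction]
  simp_rw [hw, hglue]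
  have hn : ∑ τ : ↥(univ : Finset V) → ℤˣ, Real.exp (β * ∑ e ∈ G.edgeFinset, bondSpin (eqv τ) e) * F (eqv τ) =
      ∑ σ : SpinConfig V, F σ * Real.exp (β * ∑ e ∈ G.edgeFinset, bondSpin σ e) :=
    Fintype.sum_equiv eqv _ _ fun τ => mul_comm _ _
  have hd : ∑ τ : ↥(univ : Finset V) → ℤˣ, Real.exp (β * ∑ e ∈ G.edgeFinset, bondSpin (eqv τ) e) =
      ∑ σ : SpinConfig V, Real.exp (β * ∑ e ∈ G.edgeFinset, bondSpin σ e) :=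
    Fintype.sum_equiv eqv _ _ fun τ => rfl
  rw [hn, hd]

end WholeGraph

/-! ### Summing out the decorations -/

/-- The effective coupling `K(β₀) = ½ log cosh(2β₀)` produced by one decoration spin at coupling
`β₀` (`e^{2K} = cosh 2β₀`, equivalently `tanh K = tanh² β₀`). [folklore] -/
def decorK (β₀ : ℝ) : ℝ := Real.log (Real.cosh (2 * β₀)) / 2

/-- `e^{K}e^{K} = cosh 2β₀`. [folklore] -/
theorem exp_decorK_mul_exp_decorK (β₀ : ℝ) :
    Real.exp (decorK β₀) * Real.exp (decorK β₀) = Real.cosh (2 * β₀) := by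
  rw [← Real.exp_add, decorK, add_halves, Real.exp_log (Real.cosh_pos _)]

/-- `K(β₀) ≥ 0`. [folklore] -/
theorem decorK_nonneg (β₀ : ℝ) : 0 ≤ decorK β₀ :=
  div_nonneg (Real.log_nonneg (Real.one_le_cosh _)) zero_le_two

/-- `K(β₀) > 0` for `β₀ ≠ 0`. [folklore] -/
theorem decorK_pos {β₀ : ℝ} (h : β₀ ≠ 0) : 0 < decorK β₀ :=
  div_pos (Real.log_pos (Real.one_lt_cosh.2 (mul_ne_zero two_ne_zero h))) zero_lt_two

/-- `K(β₀) → 0` as `β₀ → 0`. [folklore] -/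
theorem tendsto_decorK_zero : Tendsto decorK (𝓝 0) (𝓝 0) := by
  have hc : Continuous decorK := by
    unfold decorK
    refine Continuous.div_const (Continuous.log (Real.continuous_cosh.comp (continuous_const.mul continuous_id))
      fun x => (Real.cosh_pos _).ne') _
  have h0 : decorK 0 = 0 := by simp [decorK]
  simpa [h0] using hc.tendsto 0

/-- **Summing out one decoration spin**: for `u, v ∈ {±1}`,
`∑_{w=±1} e^{β₀(wu + wv)} = 2e^{K} e^{Kuv}` with `K = K(β₀)`. [folklore] -/
theorem sum_units_exp_decoration (β₀ : ℝ) {u v : ℝ} (hu : u = 1 ∨ u = -1) (hv : v = 1 ∨ v = -1) :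
    ∑ w : ℤˣ, Real.exp (β₀ * (((w : ℤ) : ℝ) * u + ((w : ℤ) : ℝ) * v)) =
      2 * Real.exp (decorK β₀) * Real.exp (decorK β₀ * (u * v)) := by
  have hKK := exp_decorK_mul_exp_decorK β₀
  rw [Real.cosh_eq] at hKK
  have hKinv : Real.exp (decorK β₀) * Real.exp (-decorK β₀) = 1 := by
    rw [← Real.exp_add, add_neg_cancel, Real.exp_zero]
  rw [UnitsInt.univ, Finset.sum_insert (by decide), Finset.sum_singleton]
  simp only [Units.val_one, Int.cast_one, Units.val_neg, Int.cast_neg]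
  rcases hu with rfl | rfl <;> rcases hv with rfl | rfl
  · rw [show β₀ * (1 * 1 + 1 * 1) = 2 * β₀ by ring, show β₀ * (-1 * 1 + -1 * 1) = -(2 * β₀) by ring,
      show decorK β₀ * (1 * 1) = decorK β₀ by ring]
    linarith
  · rw [show β₀ * (1 * 1 + 1 * -1) = 0 by ring, show β₀ * (-1 * 1 + -1 * -1) = 0 by ring,
      show decorK β₀ * (1 * -1) = -decorK β₀ by ring, Real.exp_zero, mul_assoc, hKinv]
    ring
  · rw [show β₀ * (1 * -1 + 1 * 1) = 0 by ring, show β₀ * (-1 * -1 + -1 * 1) = 0 by ring,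
      show decorK β₀ * (-1 * 1) = -decorK β₀ by ring, Real.exp_zero, mul_assoc, hKinv]
    ring
  · rw [show β₀ * (1 * -1 + 1 * -1) = -(2 * β₀) by ring, show β₀ * (-1 * -1 + -1 * -1) = 2 * β₀ by ring,
      show decorK β₀ * (-1 * -1) = decorK β₀ by ring]
    linarith

/-- The edge sum of the decorated graph in the site/decoration coordinates. [folklore] -/
theorem sum_edgeFinset_bondSpin_decor {k : ι → ι → ℕ} (hk : ∀ a, k a a = 0)
    (ρ : SpinConfig ι) (η : SpinConfig (Decor k)) :
    ∑ e ∈ (decorGraph k).edgeFinset, bondSpin (Sum.elim ρ η) e =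
      ∑ s : Decor k, (spinAt s η * spinAt s.1 ρ + spinAt s η * spinAt s.2.1 ρ) := by
  rw [sum_edgeFinset_decorGraph hk]
  rfl

omit [DecidableEq ι] in
/-- Sums over decorations are double sums over ordered pairs with multiplicity `k a b`. [folklore] -/
theorem sum_decor_eq_sum_sum {k : ι → ι → ℕ} (g : ι → ι → ℝ) :
    ∑ s : Decor k, g s.1 s.2.1 = ∑ a, ∑ b, (k a b : ℝ) * g a b := by
  rw [Fintype.sum_sigma]
  refine Finset.sum_congr rfl fun a _ => ?_
  rw [Fintype.sum_sigma]
  refine Finset.sum_congr rfl fun b _ => ?_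
  show ∑ _i : Fin (k a b), g a b = _
  rw [Finset.sum_const, Finset.card_univ, Fintype.card_fin, nsmul_eq_mul]

/-- **Summing out the decorations.** For `Φ` a function of the site spins only,
`∑_{σ on ι ⊕ Decor k} Φ(σ|_ι) e^{β₀ ∑_e σ_e} = (2e^{K})^{|Decor k|} ∑_ρ Φ(ρ) exp(∑_{a,b} K k_{a,b} ρ_aρ_b)`,
`K = K(β₀)`: the `ι`-marginal of the free Ising model on the decorated graph at coupling `β₀` is the
pair-interaction model with couplings `K(β₀) k_{a,b}` (decoration transformation). [folklore] -/
theorem sum_cfg_decor_eq {k : ι → ι → ℕ} (hk : ∀ a, k a a = 0) (β₀ : ℝ) (Φ : SpinConfig ι → ℝ) :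
    ∑ σ : SpinConfig (ι ⊕ Decor k), Φ (σ ∘ Sum.inl) *
        Real.exp (β₀ * ∑ e ∈ (decorGraph k).edgeFinset, bondSpin σ e) =
      (2 * Real.exp (decorK β₀)) ^ Fintype.card (Decor k) *
        ∑ ρ : SpinConfig ι, Φ ρ * weight (fun a b => decorK β₀ * k a b) ρ := by
  classical
  -- split the configuration into site spins `ρ` and decoration spins `η`
  have hsplit : ∑ σ : SpinConfig (ι ⊕ Decor k), Φ (σ ∘ Sum.inl) *
        Real.exp (β₀ * ∑ e ∈ (decorGraph k).edgeFinset, bondSpin σ e) =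
      ∑ ρ : SpinConfig ι, ∑ η : SpinConfig (Decor k), Φ ρ *
        Real.exp (β₀ * ∑ e ∈ (decorGraph k).edgeFinset, bondSpin (Sum.elim ρ η) e) := by
    rw [← Fintype.sum_prod_type']
    refine Fintype.sum_equiv (Equiv.sumArrowEquivProdArrow ι (Decor k) ℤˣ) _ _ fun σ => ?_
    show Φ (σ ∘ Sum.inl) * _ = Φ (σ ∘ Sum.inl) *
      Real.exp (β₀ * ∑ e ∈ (decorGraph k).edgeFinset, bondSpin (Sum.elim (σ ∘ Sum.inl) (σ ∘ Sum.inr)) e)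
    rw [Sum.elim_comp_inl_inr]
  rw [hsplit, Finset.mul_sum]
  refine Finset.sum_congr rfl fun ρ _ => ?_
  -- the sum over the decoration spins factorises
  set f : Decor k → ℤˣ → ℝ := fun s w =>
    Real.exp (β₀ * (((w : ℤ) : ℝ) * spinAt s.1 ρ + ((w : ℤ) : ℝ) * spinAt s.2.1 ρ)) with hf
  have hinner : ∑ η : SpinConfig (Decor k),
      Real.exp (β₀ * ∑ e ∈ (decorGraph k).edgeFinset, bondSpin (Sum.elim ρ η) e) =
      ∏ s : Decor k, (2 * Real.exp (decorK β₀) * Real.exp (decorK β₀ * (spinAt s.1 ρ * spinAt s.2.1 ρ))) := by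
    have h1 : ∀ η : SpinConfig (Decor k),
        Real.exp (β₀ * ∑ e ∈ (decorGraph k).edgeFinset, bondSpin (Sum.elim ρ η) e) = ∏ s : Decor k, f s (η s) := by
      intro η
      rw [sum_edgeFinset_bondSpin_decor hk, Finset.mul_sum, Real.exp_sum]
      rfl
    calc ∑ η : SpinConfig (Decor k), Real.exp (β₀ * ∑ e ∈ (decorGraph k).edgeFinset, bondSpin (Sum.elim ρ η) e)
        = ∑ η : Decor k → ℤˣ, ∏ s : Decor k, f s (η s) := Finset.sum_congr rfl fun η _ => h1 η
      _ = ∏ s : Decor k, ∑ w : ℤˣ, f s w := (Fintype.prod_sum f).symm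
      _ = _ := Finset.prod_congr rfl fun s _ =>
          sum_units_exp_decoration β₀ (spinAt_eq_one_or_eq_neg_one _ _) (spinAt_eq_one_or_eq_neg_one _ _)
  rw [← Finset.mul_sum, hinner, Finset.prod_mul_distrib, Finset.prod_const, Finset.card_univ, ← Real.exp_sum,
    weight]
  have hexp : ∑ s : Decor k, decorK β₀ * (spinAt s.1 ρ * spinAt s.2.1 ρ) =
      ∑ a, ∑ b, decorK β₀ * k a b * (spinAt a ρ * spinAt b ρ) := by
    rw [sum_decor_eq_sum_sum (k := k) fun a b => decorK β₀ * (spinAt a ρ * spinAt b ρ)]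
    refine Finset.sum_congr rfl fun a _ => Finset.sum_congr rfl fun b _ => ?_
    ring
  rw [hexp]
  ring

/-- **The `ι`-marginal of the decorated model**: for every observable `Φ` of the site spins,
`⟨Φ(σ|_ι)⟩^{free}_{decorGraph k; β₀, 0} = ⟨Φ⟩_{K(β₀)k}`. [folklore] -/
theorem isingExpect_decorGraph_comp_inl {k : ι → ι → ℕ} (hk : ∀ a, k a a = 0) (β₀ : ℝ)
    (Φ : SpinConfig ι → ℝ) :
    isingExpect (decorGraph k) univ β₀ 0 .free (fun σ => Φ (σ ∘ Sum.inl)) =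
      avg (fun a b => decorK β₀ * k a b) Φ := by
  classical
  rw [isingExpect_univ_free_eq_sum_div, sum_cfg_decor_eq hk β₀ Φ, avg]
  have h1 := sum_cfg_decor_eq hk β₀ (fun _ => (1 : ℝ))
  simp only [one_mul] at h1
  rw [h1, mul_div_mul_left _ _ (pow_ne_zero _ (mul_ne_zero two_ne_zero (Real.exp_pos _).ne'))]


/-! ### The Gaussian inequality for general nonnegative pair couplings -/

/-- **Pairing bound for decorated couplings.** For couplings `K(β₀)·k_{a,b}`, `k` integer-valued and
vanishing on the diagonal, `β₀ ≥ 0`: `⟨σ_{x₁}⋯σ_{x₂ₘ}⟩ ≤ 𝒢_m[⟨σσ⟩](x)` — the tree's Gaussian inequality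
`nPoint_le_pairingSum_univ_free` on the decorated graph, restricted to site spins.
[cite: AizenmanDuminilCopinAnnals2021, arXiv:1912.07973 §6.3, first display, lower inequality (p. 26)] -/
theorem avg_spinMonomial_le_pairingSum_decor {k : ι → ι → ℕ} (hk : ∀ a, k a a = 0) {β₀ : ℝ}
    (hβ₀ : 0 ≤ β₀) (m : ℕ) (x : Fin (2 * m) → ι) :
    avg (fun a b => decorK β₀ * k a b) (spinMonomial x) ≤
      pairingSum (fun a b => avg (fun a b => decorK β₀ * k a b) (spinPair a b)) m x := by
  classical
  have h := nPoint_le_pairingSum_univ_free (decorGraph k) hβ₀ m (Sum.inl ∘ x)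
  have hN : nPoint (isingMeasure (decorGraph k) univ β₀ 0 .free) spinAt (Sum.inl ∘ x) =
      avg (fun a b => decorK β₀ * k a b) (spinMonomial x) := by
    rw [← isingExpect_decorGraph_comp_inl hk β₀ (spinMonomial x)]
    rfl
  have h2 : ∀ a b : ι,
      twoPoint (isingMeasure (decorGraph k) univ β₀ 0 .free) spinAt (Sum.inl a) (Sum.inl b) =
        avg (fun a b => decorK β₀ * k a b) (spinPair a b) := by
    intro a b
    rw [← isingExpect_decorGraph_comp_inl hk β₀ (spinPair a b)]
    rfl
  rw [hN, pairingSum_congr_of_eq _ (fun a b => avg (fun a b => decorK β₀ * k a b) (spinPair a b)) m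
    (Sum.inl ∘ x) x (fun i j => h2 (x i) (x j))] at h
  exact h

/-- The approximating couplings `K_n ⌊c/K_n⌋₊`, `K_n = K(1/(n+1)) → 0⁺`, converge to `c ≥ 0`. [folklore] -/
theorem tendsto_decorK_mul_floor {c : ℝ} (hc : 0 ≤ c) :
    Tendsto (fun n : ℕ => decorK (1 / ((n : ℝ) + 1)) * (⌊c / decorK (1 / ((n : ℝ) + 1))⌋₊ : ℝ))
      atTop (𝓝 c) := by
  have hKpos : ∀ n : ℕ, 0 < decorK (1 / ((n : ℝ) + 1)) := fun n =>
    decorK_pos (one_div_ne_zero (by positivity))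
  have hK0 : Tendsto (fun n : ℕ => decorK (1 / ((n : ℝ) + 1))) atTop (𝓝 0) :=
    tendsto_decorK_zero.comp tendsto_one_div_add_atTop_nhds_zero_nat
  have hlow : Tendsto (fun n : ℕ => c - decorK (1 / ((n : ℝ) + 1))) atTop (𝓝 c) := by
    simpa using tendsto_const_nhds.sub hK0
  refine tendsto_of_tendsto_of_tendsto_of_le_of_le hlow tendsto_const_nhds (fun n => ?_) (fun n => ?_)
  · have h1 := Nat.lt_floor_add_one (c / decorK (1 / ((n : ℝ) + 1)))
    have h2 : c < decorK (1 / ((n : ℝ) + 1)) * (⌊c / decorK (1 / ((n : ℝ) + 1))⌋₊ : ℝ) +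
        decorK (1 / ((n : ℝ) + 1)) := by
      have := mul_lt_mul_of_pos_left h1 (hKpos n)
      rwa [mul_div_cancel₀ _ (hKpos n).ne', mul_add, mul_one] at this
    dsimp only
    linarith
  · have h1 := Nat.floor_le (div_nonneg hc (hKpos n).le)
    have := mul_le_mul_of_nonneg_left h1 (hKpos n).le
    rwa [mul_div_cancel₀ _ (hKpos n).ne'] at this

/-- **Newman's Gaussian inequality for general ferromagnetic pair interactions on a finite set,
zero field** (the lower half of Aizenman's inequality): for off-diagonal couplings `c_{a,b} ≥ 0`
(`a ≠ b`; the diagonal is not seen by the averages, `avg_offDiag`) and any `2m` sites,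
`⟨σ_{x₁}⋯σ_{x₂ₘ}⟩_c ≤ 𝒢_m[⟨σσ⟩_c](x₁,…,x₂ₘ)`. Newman's Theorem 3 (eqs. (3.6)–(3.7)) is printed for
spin-½ pair interactions `J_{ij} ≥ 0` in external fields `h_i ≥ 0`; this is its zero-field case.
Obtained from the unit-coupling graph case through the decoration transformation (couplings
`K_n⌊c/K_n⌋₊ → c`) and continuity of finite-volume expectations in the couplings.
[cite: Newman1975Gaussian, Theorem 3, eqs. (3.6)-(3.7)] -/
theorem avg_spinMonomial_le_pairingSum (c : ι → ι → ℝ) (hc : ∀ a b, a ≠ b → 0 ≤ c a b) (m : ℕ)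
    (x : Fin (2 * m) → ι) :
    avg c (spinMonomial x) ≤ pairingSum (fun a b => avg c (spinPair a b)) m x := by
  classical
  set K : ℕ → ℝ := fun n => decorK (1 / ((n : ℝ) + 1)) with hK
  set kn : ℕ → ι → ι → ℕ := fun n a b => if a = b then 0 else ⌊c a b / K n⌋₊ with hkn
  set cn : ℕ → ι → ι → ℝ := fun n a b => K n * (kn n a b : ℝ) with hcn
  have hkn0 : ∀ n a, kn n a a = 0 := fun n a => by simp [hkn]
  have hconv : Tendsto cn atTop (𝓝 (offDiag c)) := by
    rw [tendsto_pi_nhds]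
    intro a
    rw [tendsto_pi_nhds]
    intro b
    by_cases hab : a = b
    · simp only [hcn, hkn, offDiag, if_pos hab, Nat.cast_zero, mul_zero]
      exact tendsto_const_nhds
    · simp only [hcn, hkn, hK, offDiag, if_neg hab]
      exact tendsto_decorK_mul_floor (hc a b hab)
  have hineq : ∀ n, avg (cn n) (spinMonomial x) ≤ pairingSum (fun a b => avg (cn n) (spinPair a b)) m x :=
    fun n => avg_spinMonomial_le_pairingSum_decor (hkn0 n) (by positivity) m x
  have hl : Tendsto (fun n => avg (cn n) (spinMonomial x)) atTop (𝓝 (avg (offDiag c) (spinMonomial x))) :=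
    ((continuous_avg _).tendsto _).comp hconv
  have hr : Tendsto (fun n => pairingSum (fun a b => avg (cn n) (spinPair a b)) m x) atTop
      (𝓝 (pairingSum (fun a b => avg (offDiag c) (spinPair a b)) m x)) :=
    tendsto_pairingSum (fun a b => ((continuous_avg (spinPair a b)).tendsto _).comp hconv) m x
  have hlim := le_of_tendsto_of_tendsto' hl hr hineq
  simpa only [avg_offDiag] using hlim

/-- **Newman's Gaussian domination of even moments** (Newman 1975, Theorem 5, eq. (2.8)) for the
pair-interaction Ising model with couplings `c ≥ 0` on a finite set and `X = ∑_a g_a σ_a`, `g ≥ 0`: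
`⟨X^{2m}⟩ ≤ (2m)!/(2^m m!) ⟨X²⟩^m` (zero field; off-diagonal couplings `c_{a,b} ≥ 0`). Here derived
from the pairing bound by smearing Wick's law (`sum_prod_mul_pairingSum`). [cite: Newman1975, Theorem 5, eq. (2.8)] -/
theorem avg_pow_two_mul_le (c : ι → ι → ℝ) (hc : ∀ a b, a ≠ b → 0 ≤ c a b) (g : ι → ℝ)
    (hg : ∀ a, 0 ≤ g a) (m : ℕ) :
    avg c (fun ρ => (∑ a, g a * spinAt a ρ) ^ (2 * m)) ≤
      ((2 * m)! : ℝ) / (2 ^ m * m !) * avg c (fun ρ => (∑ a, g a * spinAt a ρ) ^ 2) ^ m := by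
  classical
  have hexp : ∀ ρ : SpinConfig ι, (∑ a, g a * spinAt a ρ) ^ (2 * m) =
      ∑ p ∈ Fintype.piFinset (fun _ : Fin (2 * m) => (univ : Finset ι)), (∏ i, g (p i)) * spinMonomial p ρ := by
    intro ρ
    rw [Finset.sum_pow']
    refine Finset.sum_congr rfl fun p _ => ?_
    rw [spinMonomial, ← Finset.prod_mul_distrib]
  have hL : avg c (fun ρ => (∑ a, g a * spinAt a ρ) ^ (2 * m)) =
      ∑ p ∈ Fintype.piFinset (fun _ : Fin (2 * m) => (univ : Finset ι)),
        (∏ i, g (p i)) * avg c (spinMonomial p) := by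
    simp_rw [hexp]
    rw [avg_finset_sum]
    exact Finset.sum_congr rfl fun p _ => avg_const_mul c _ _
  have h2 : avg c (fun ρ => (∑ a, g a * spinAt a ρ) ^ 2) = ∑ a, ∑ b, g a * g b * avg c (spinPair a b) := by
    have hsq : ∀ ρ : SpinConfig ι, (∑ a, g a * spinAt a ρ) ^ 2 = ∑ a, ∑ b, g a * g b * spinPair a b ρ := by
      intro ρ
      rw [sq, Finset.sum_mul_sum]
      refine Finset.sum_congr rfl fun a _ => Finset.sum_congr rfl fun b _ => ?_
      rw [spinPair]
      ring
    simp_rw [hsq]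
    rw [avg_finset_sum]
    refine Finset.sum_congr rfl fun a _ => ?_
    rw [avg_finset_sum]
    exact Finset.sum_congr rfl fun b _ => avg_const_mul c _ _
  rw [hL, h2, ← sum_prod_mul_pairingSum univ g (fun a b => avg c (spinPair a b)) m]
  refine Finset.sum_le_sum fun p _ => ?_
  exact mul_le_mul_of_nonneg_left (avg_spinMonomial_le_pairingSum c hc m p)
    (Finset.prod_nonneg fun i _ => hg _)

end PairIsing

end Literature.Probability.LatticeModels

end
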